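import Summits.QuantumFields.YangMills.Theorems.IR.EsPolymerGasPeierls2K

/-!
# Crux `IR` (item stmt-QuantumFields-19354) — line «es-polymer-decoupling», reshaped engine, input (c), part 3/3:
# TWO-REGION EXPONENTIAL MIXING OF THE HARD-CORE CELL GAS; CLUSTERING OF RADIUS-`k` BLOCK OBSERVABLES UNDER (P), (I)_k, (D)_k

Helper module for item `stmt-QuantumFields-19354` (`--supports … --as helper`; it closes nothing).  Concludes
`Theorems/IR/EsPolymerGasSwapK.lean` + `EsPolymerGasPeierls2K.lean`: the swapping map (part 1) and the tree's PROVED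
Adhikari–Cao Lemma 3.2 `norm_fcov_le_of_isSwappingMap` give `|Cov_g(Φ_A∘nearFamily_A, Φ_B∘nearFamily_B)| ≤ 2 C_A C_B · g⊗g(goodᶜ)`,
and part 2 bounds `g⊗g(goodᶜ)`.  Results: `gasCov_nearFamily_le` — INPUT (c) AS THE LEAD PHRASED IT: for bounded functionals
of the near families of the radius-`k` blocks about `c_A`, `c_B`,
`|∑ g Φ_AΦ_B − (∑ g Φ_A)(∑ g Φ_B)| ≤ 4 C_A C_B (2k+3)⁴ (2√p)^{(cellDist c_A c_B − (2k+2))/6 + 2}` once `(13⁴+1)² · 2√p ≤ 1/2`;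
`exists_bounded_tag` — clause (D)_k may be read with a functional clamped to `[−C_A, C_A]`; and `abs_blockCov_le_pow` —
inputs (a)+(b) (the lead's `abs_cov_sub_gasCov_le_pow`, BY NAME) + (c): for radius-`k` block observables under clauses (P),
(I)_k, (D)_k, `|Cov_μ(A,B)| ≤ 8 C_A C_B (2k+3)⁴ (2√p)^{(cellDist c_A c_B − (2k+2))/6 + 2}`.  What then remains of
`PolymerEngineK` is the species ↦ block bookkeeping at mesh `⌈ℓ/a β⌉` (the lead's item (d)); the smallness threshold is
`p₀ ≤ 1/(16 (13⁴+1)⁴) ≈ 9.4·10⁻²⁰` (format-validation regime, as for the lead's inputs).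

HONEST FRAMING: elementary finite combinatorics for ONE input of an OPEN, PROVABLE engine stub of a CONDITIONAL rung
line; the load of that line, `stub_polymerCertK : IRPolymerCertK` (a disjoint-polymer representation of lattice
Yang–Mills at every large β — the weak-coupling mass gap in polymer clothes), is untouched; nothing here proves
clustering of lattice Yang–Mills, `BalabanLadder.IR`, or the Clay Yang–Mills problem; R4 closes only the conditional
finite-𝕋⁴ rung `BalabanLadder.UV`.  No `Prop`-valued definitions, no Theses conclusion.  Authored by the ideator seat
ym-ir-idea-1 (g7) as a stub-level service for the lead prover ym-ir-line-mxc-p1 (RULING g9-№2; line verdicts crit-1 /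
crit-2 PASS-WITH-PRICE 2026-08-28T00:01Z / 00:04Z: engine allowed, no prover on the load).
References: [cite: AdhikariCao2025, Lemma 3.2].
-/

set_option autoImplicit false

noncomputable section

open MeasureTheory Finset Function
open Literature.MathematicalPhysics.QuantumFieldTheory
open Literature.MathematicalPhysics.QuantumFieldTheory.AdhikariCao2022 (IsSwappingMap fexpect fcov pairProbNotMem
  norm_fcov_le_of_isSwappingMap)
open Literature.Probability.LatticeModels (IsRConnected sum_pow_card_le_of_connected)

namespace Summit.QuantumFields.YangMills.Cruxes.IR.EsPolymer

namespace GasMixing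

variable {q : ℕ}

/-! ## §5 Compositions -/

/-- From the smallness condition: `2√p ≤ 1/2`, hence `p ≤ 1`. -/
theorem p_le_one_of_small {p : ℝ} (hp : 0 ≤ p) (hsmall : ((13 : ℝ) ^ 4 + 1) ^ 2 * (2 * Real.sqrt p) ≤ 1 / 2) :
    2 * Real.sqrt p ≤ 1 / 2 ∧ p ≤ 1 := by
  have hs0 := Real.sqrt_nonneg p
  have hK : (1 : ℝ) ≤ ((13 : ℝ) ^ 4 + 1) ^ 2 := by norm_num
  have hs : 2 * Real.sqrt p ≤ 1 / 2 := by
    have := mul_le_mul_of_nonneg_right hK (by positivity : (0 : ℝ) ≤ 2 * Real.sqrt p)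
    linarith
  refine ⟨hs, ?_⟩
  have hs1 : Real.sqrt p ≤ 1 := by linarith
  calc p = Real.sqrt p ^ 2 := (Real.sq_sqrt hp).symm
    _ ≤ 1 ^ 2 := pow_le_pow_left₀ hs0 hs1 2
    _ = 1 := one_pow 2

/-- **Input (c), as the lead phrased it: exponential two-region mixing of the hard-core cell gas for near-family
functionals** (bounded functionals; rate uniform in `Φ_A, Φ_B`, prefactor `(2k+3)⁴`). -/
theorem gasCov_nearFamily_le [NeZero q] {g : Finset (Finset (Cell q)) → ℝ} {act : Finset (Cell q) → ℝ} {Z p : ℝ}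
    (hg0 : ∀ Γ, 0 ≤ g Γ) (hg1 : ∑ Γ, g Γ = 1) (hgc : ∀ Γ, ¬ Compatible Γ → g Γ = 0)
    (hmass : ∀ Γ, Compatible Γ → g Γ = Z⁻¹ * ∏ γ ∈ Γ, act γ) (hact : ∀ γ, 0 ≤ act γ)
    (hactp : ∀ γ, act γ ≤ p ^ γ.card) (hp : 0 ≤ p) (hsmall : ((13 : ℝ) ^ 4 + 1) ^ 2 * (2 * Real.sqrt p) ≤ 1 / 2)
    (k : ℕ) (cA cB : Cell q) (ΦA ΦB : Finset (Finset (Cell q)) → ℝ) {CA CB : ℝ} (hA : ∀ F, |ΦA F| ≤ CA)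
    (hB : ∀ F, |ΦB F| ≤ CB) :
    |(∑ Γ, g Γ * (ΦA (nearFamily Γ cA k) * ΦB (nearFamily Γ cB k))) -
        (∑ Γ, g Γ * ΦA (nearFamily Γ cA k)) * (∑ Γ, g Γ * ΦB (nearFamily Γ cB k))| ≤
      4 * CA * CB * ((2 * k + 3 : ℕ) : ℝ) ^ 4 * (2 * Real.sqrt p) ^ ((cellDist cA cB - (2 * k + 2)) / 6 + 2) := by
  classical
  set h₁ : Finset (Finset (Cell q)) → ℂ := fun Γ => (ΦA (nearFamily Γ cA k) : ℂ) with hh₁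
  set h₂ : Finset (Finset (Cell q)) → ℂ := fun Γ => (ΦB (nearFamily Γ cB k) : ℂ) with hh₂
  have hT : IsSwappingMap g (good cA cB k) h₁ h₂ (swap cB k) := swap_isSwappingMap hgc hmass k cA cB ΦA ΦB
  have hM₁ : ∀ Γ, ‖h₁ Γ‖ ≤ CA := fun Γ => by
    simp only [hh₁, Complex.norm_real, Real.norm_eq_abs]; exact hA _
  have hM₂ : ∀ Γ, ‖h₂ Γ‖ ≤ CB := fun Γ => by
    simp only [hh₂, Complex.norm_real, Real.norm_eq_abs]; exact hB _
  have hcov := norm_fcov_le_of_isSwappingMap hg0 hg1 hT hM₁ hM₂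
  have hcast : fcov g h₁ h₂ = (((∑ Γ, g Γ * (ΦA (nearFamily Γ cA k) * ΦB (nearFamily Γ cB k))) -
        (∑ Γ, g Γ * ΦA (nearFamily Γ cA k)) * (∑ Γ, g Γ * ΦB (nearFamily Γ cB k)) : ℝ) : ℂ) := by
    simp only [fcov, fexpect, hh₁, hh₂]; push_cast; rfl
  rw [hcast, Complex.norm_real, Real.norm_eq_abs] at hcov
  have hp1 : p ≤ 1 := (p_le_one_of_small hp hsmall).2
  have h2 := pairProbNotMem_good_le hg0 hg1 hgc hmass hact hactp hp hp1 k cA cB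
  have h3 := sum_animals_pow_le hp hsmall k cA cB
  have hCA : 0 ≤ CA := (abs_nonneg _).trans (hA ∅)
  have hCB : 0 ≤ CB := (abs_nonneg _).trans (hB ∅)
  calc _ ≤ 2 * CA * CB * pairProbNotMem g (good cA cB k) := hcov
    _ ≤ 2 * CA * CB * (2 * ((2 * k + 3 : ℕ) : ℝ) ^ 4 *
          (2 * Real.sqrt p) ^ ((cellDist cA cB - (2 * k + 2)) / 6 + 2)) :=
        mul_le_mul_of_nonneg_left (h2.trans h3) (by positivity)
    _ = _ := by ring

section Block

variable {G : Type} [MeasurableSpace G] {N : ℕ}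
  (ν : Finset (Finset (Cell q)) → Measure (GaugeConfig 4 N G)) (μ : Measure (GaugeConfig 4 N G))
  [IsProbabilityMeasure μ] (hsum : Finset.univ.sum ν = μ) (hν0 : ∀ Γ, ¬ Compatible Γ → ν Γ = 0)

include hsum hν0

omit hν0 in
/-- Clause (D)_k may be read with a BOUNDED functional: clamp `Φ` to `[−C_A, C_A]` (where `ν_Γ(1) > 0` the clause forces
`|Φ| ≤ C_A`; where `ν_Γ(1) = 0` the sub-measure vanishes). -/
theorem exists_bounded_tag [Nonempty G] {A : GaugeConfig 4 N G → ℝ} {CA : ℝ}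
    (hA : ∀ U, |A U| ≤ CA) (k : ℕ) (cA : Cell q) (ΦA : Finset (Finset (Cell q)) → ℝ)
    (hΦA : ∀ Γ, Compatible Γ → ∫ U, A U ∂(ν Γ) = (ν Γ Set.univ).toReal * ΦA (nearFamily Γ cA k)) :
    ∃ Φ : Finset (Finset (Cell q)) → ℝ, (∀ F, |Φ F| ≤ CA) ∧
      ∀ Γ, Compatible Γ → ∫ U, A U ∂(ν Γ) = (ν Γ Set.univ).toReal * Φ (nearFamily Γ cA k) := by
  have hCA : 0 ≤ CA := (abs_nonneg _).trans (hA fun _ => Classical.arbitrary G)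
  refine ⟨fun F => max (-CA) (min CA (ΦA F)), fun F => ?_, fun Γ hΓ => ?_⟩
  · rw [abs_le]
    exact ⟨le_max_left _ _, max_le (by linarith) (min_le_left _ _)⟩
  · haveI := isFiniteMeasure_sub ν μ hsum Γ
    set P : ℝ := (ν Γ Set.univ).toReal with hP
    have hP0 : 0 ≤ P := ENNReal.toReal_nonneg
    rcases hP0.lt_or_eq with hPpos | hPzero
    · -- the clause forces `|ΦA| ≤ CA`, so the clamp is the identity
      have hbound : |P * ΦA (nearFamily Γ cA k)| ≤ CA * P := by
        rw [← hΦA Γ hΓ]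
        have h := norm_integral_le_of_norm_le_const (μ := ν Γ) (f := A) (C := CA)
          (ae_of_all _ fun U => by rw [Real.norm_eq_abs]; exact hA U)
        simpa [Real.norm_eq_abs, hP, Measure.real, mul_comm] using h
      have hΦle : |ΦA (nearFamily Γ cA k)| ≤ CA := by
        rw [abs_mul, abs_of_pos hPpos] at hbound
        nlinarith
      rw [abs_le] at hΦle
      show ∫ U, A U ∂(ν Γ) = P * max (-CA) (min CA (ΦA (nearFamily Γ cA k)))
      rw [min_eq_right hΦle.2, max_eq_right hΦle.1, hP]
      exact hΦA Γ hΓ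
    · have hν : ν Γ = 0 := sub_eq_zero_of_mass ν (Γ := Γ) hPzero.symm
      show ∫ U, A U ∂(ν Γ) = P * _
      rw [← hPzero, hν]; simp

/-- **(a)+(b)+(c): exponential clustering of radius-`k` block observables under clauses (P), (I)_k, (D)_k** — the lead's
`abs_cov_sub_gasCov_le_pow` plus `gasCov_nearFamily_le`:
`|Cov_μ(A,B)| ≤ 8 C_A C_B (2k+3)⁴ (2√p)^{(cellDist c_A c_B − (2k+2))/6 + 2}` once `(13⁴+1)² · 2√p ≤ 1/2`.  What remains of
`PolymerEngineK` after this is the species ↦ block bookkeeping at mesh `⌈ℓ/a β⌉` (lead's item (d)). -/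
theorem abs_blockCov_le_pow [Nonempty G] [NeZero q] {A B : GaugeConfig 4 N G → ℝ} (hAm : Measurable A)
    (hBm : Measurable B) {CA CB : ℝ} (hA : ∀ U, |A U| ≤ CA) (hB : ∀ U, |B U| ≤ CB) (k : ℕ) (cA cB : Cell q)
    (act : Finset (Cell q) → ℝ) (hact : ∀ γ, 0 ≤ act γ) {Z p : ℝ}
    (hmass : ∀ Γ, Compatible Γ → (ν Γ Set.univ).toReal = Z⁻¹ * ∏ γ ∈ Γ, act γ) (hp : 0 ≤ p)
    (hactp : ∀ γ, act γ ≤ p ^ γ.card) (hsmall : ((13 : ℝ) ^ 4 + 1) ^ 2 * (2 * Real.sqrt p) ≤ 1 / 2)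
    (hI : ∀ Γ, Compatible Γ → Disjoint (nearFamily Γ cA k) (nearFamily Γ cB k) →
      (ν Γ Set.univ).toReal * ∫ U, A U * B U ∂(ν Γ) = (∫ U, A U ∂(ν Γ)) * (∫ U, B U ∂(ν Γ)))
    (ΦA ΦB : Finset (Finset (Cell q)) → ℝ)
    (hΦA : ∀ Γ, Compatible Γ → ∫ U, A U ∂(ν Γ) = (ν Γ Set.univ).toReal * ΦA (nearFamily Γ cA k))
    (hΦB : ∀ Γ, Compatible Γ → ∫ U, B U ∂(ν Γ) = (ν Γ Set.univ).toReal * ΦB (nearFamily Γ cB k)) :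
    |(∫ U, A U * B U ∂μ) - (∫ U, A U ∂μ) * (∫ U, B U ∂μ)| ≤
      8 * CA * CB * ((2 * k + 3 : ℕ) : ℝ) ^ 4 * (2 * Real.sqrt p) ^ ((cellDist cA cB - (2 * k + 2)) / 6 + 2) := by
  obtain ⟨ΦA', hA', hΦA'⟩ := exists_bounded_tag ν μ hsum hA k cA ΦA hΦA
  obtain ⟨ΦB', hB', hΦB'⟩ := exists_bounded_tag ν μ hsum hB k cB ΦB hΦB
  have hs0 := Real.sqrt_nonneg p
  have hsmall' : ((13 : ℝ) ^ 4 + 1) ^ 2 * Real.sqrt p ≤ 1 / 2 := by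
    have : ((13 : ℝ) ^ 4 + 1) ^ 2 * Real.sqrt p ≤ ((13 : ℝ) ^ 4 + 1) ^ 2 * (2 * Real.sqrt p) :=
      mul_le_mul_of_nonneg_left (by linarith) (by positivity)
    linarith
  have h1 := abs_cov_sub_gasCov_le_pow ν μ hsum hν0 hAm hBm hA hB k cA cB act hact hmass hp hactp hsmall' hI
    ΦA' ΦB' hΦA' hΦB'
  have h2 := gasCov_nearFamily_le (g := fun Γ => (ν Γ Set.univ).toReal) (fun _ => ENNReal.toReal_nonneg)
    (sum_mass_eq_one ν μ hsum) (fun Γ hΓ => by simp [hν0 Γ hΓ]) hmass hact hactp hp hsmall k cA cB ΦA' ΦB' hA' hB'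
  have hCA : 0 ≤ CA := (abs_nonneg _).trans (hA fun _ => Classical.arbitrary G)
  have hCB : 0 ≤ CB := (abs_nonneg _).trans (hB fun _ => Classical.arbitrary G)
  set e : ℕ := (cellDist cA cB - (2 * k + 2)) / 6 + 2 with he
  have hpow : Real.sqrt p ^ e ≤ (2 * Real.sqrt p) ^ e := pow_le_pow_left₀ hs0 (by linarith) e
  set cov : ℝ := (∫ U, A U * B U ∂μ) - (∫ U, A U ∂μ) * (∫ U, B U ∂μ) with hcov
  set gas : ℝ := (∑ Γ, (ν Γ Set.univ).toReal * (ΦA' (nearFamily Γ cA k) * ΦB' (nearFamily Γ cB k))) -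
      (∑ Γ, (ν Γ Set.univ).toReal * ΦA' (nearFamily Γ cA k)) *
        (∑ Γ, (ν Γ Set.univ).toReal * ΦB' (nearFamily Γ cB k)) with hgas
  have hK : 0 ≤ 4 * CA * CB * ((2 * k + 3 : ℕ) : ℝ) ^ 4 := by positivity
  calc |cov| = |(cov - gas) + gas| := by ring_nf
    _ ≤ |cov - gas| + |gas| := abs_add_le _ _
    _ ≤ 4 * CA * CB * ((2 * k + 3 : ℕ) : ℝ) ^ 4 * Real.sqrt p ^ e +
          4 * CA * CB * ((2 * k + 3 : ℕ) : ℝ) ^ 4 * (2 * Real.sqrt p) ^ e := add_le_add h1 h2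
    _ ≤ 4 * CA * CB * ((2 * k + 3 : ℕ) : ℝ) ^ 4 * (2 * Real.sqrt p) ^ e +
          4 * CA * CB * ((2 * k + 3 : ℕ) : ℝ) ^ 4 * (2 * Real.sqrt p) ^ e :=
        add_le_add (mul_le_mul_of_nonneg_left hpow hK) le_rfl
    _ = _ := by ring

end Block

end GasMixing

end Summit.QuantumFields.YangMills.Cruxes.IR.EsPolymer

end
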